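import Literature.MathematicalPhysics.QuantumFieldTheory.OSSkeletonVFunctional
import Literature.MathematicalPhysics.QuantumFieldTheory.OSLogSlotAnalyticity
import Mathlib.Analysis.SpecialFunctions.Complex.LogDeriv
import HarnessLib

/-!
# Joint real analyticity of the directional skeleton Schwinger function (OS II, Ch. V, Method B, Thm. 4.1')

Topic `Literature/MathematicalPhysics/QuantumFieldTheory`. Osterwalder–Schrader II (Comm. Math. Phys. 42
(1975)), Ch. V.1, Theorem 4.1' ("the `S_k(ξ)` are real analytic functions in all variables"):
with the slot structure of `OSSkeletonVFunctional` — every directional variable `u_{iμ}` of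
`𝒮(u) = 𝔖_{k+2}(⊗ⱼ φⱼ(· - pⱼ(u)))`, `pⱼ(u) = ∑_{i<j}(ξᵢ + ∑_μ u_{iμ} ê_μ)`, is a holomorphic
semigroup slot in the frame of `ê_μ` — the generic engine `LogSlot.exists_holomorphic_extension_logDensity`
(flat tube theorem in the logarithmic variables) yields (`exists_holomorphic_extension_skelSV`):
there is `F` holomorphic on the tube `{∑_{(i,μ)} |Im z_{iμ}| < π/2}` (indexed by `Fin ((k+1)d)`
through `slotEquiv`), bounded on closed sub-tubes, with

  `F(x) = e^{-2b∑x²} 𝒮(eˣ)` at real points: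

the profile-smeared Schwinger function is **real-analytic jointly in all `(k+1)d` directional
variables** on `(0,∞)^{(k+1)d}`, with a holomorphic extension to `{∑ |arg u_{iμ}| < π/2}` — for
`d` linearly independent directions `ê_μ` this is real analyticity in all (time and space)
variables of the configuration, OS's Theorem 4.1' for `𝔖` smeared with the fixed profiles `φⱼ`.

## References

* K. Osterwalder, R. Schrader, *Axioms for Euclidean Green's functions II*, Comm. Math. Phys.
  42 (1975) 281–305, Ch. V.1 pp. 291–292, Thm. 4.1', (5.7)–(5.8). [OsterwalderSchraderCMP1975]
-/

noncomputable section

open MeasureTheory Set Filter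
open _root_.Topology
open scoped InnerProductSpace RealInnerProductSpace NNReal SchwartzMap

namespace Literature.MathematicalPhysics.QuantumFieldTheory

variable {d : ℕ} [NeZero d]

open Literature.MathematicalPhysics.QuantumLattice (SchwingerFamily IsPositiveTimeMulti)
open Literature.MathematicalPhysics.QuantumLattice.SchwingerFamily
open OSFrames

/-! ### Reindexing the slots `Fin (k+1) × Fin d ≃ Fin (K+1)` -/

section Reindex

/-- The number of slots minus one: `K = (k+1)n - 1` (`n` the number of directions). [folklore] -/
def slotK (k n : ℕ) : ℕ := (k + 1) * n - 1

/-- `K + 1 = (k+1) n` for `n ≥ 1`. [folklore] -/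
theorem slotK_add_one (k n : ℕ) [NeZero n] : slotK k n + 1 = (k + 1) * n := by
  have hn : 1 ≤ n := NeZero.one_le
  have : 1 ≤ (k + 1) * n := by nlinarith
  unfold slotK; omega

/-- The **slot reindexing** `Fin (K+1) ≃ Fin (k+1) × Fin n`. [folklore] -/
def slotEquiv (k n : ℕ) [NeZero n] : Fin (slotK k n + 1) ≃ Fin (k + 1) × Fin n :=
  (finCongr (slotK_add_one k n)).trans finProdFinEquiv.symm

variable {k n : ℕ} [NeZero n]

/-- Parameters indexed by `Fin (K+1)` as parameters indexed by `Fin (k+1) × Fin n`. [folklore] -/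
def reindexV (v : Fin (slotK k n + 1) → ℝ) : Fin (k + 1) × Fin n → ℝ := fun p => v ((slotEquiv k n).symm p)

/-- Reindexing preserves the sup norm. [folklore] -/
theorem norm_reindexV (v : Fin (slotK k n + 1) → ℝ) : ‖reindexV v‖ = ‖v‖ := by
  refine le_antisymm ((pi_norm_le_iff_of_nonneg (norm_nonneg _)).2 fun p => norm_le_pi_norm v _)
    ((pi_norm_le_iff_of_nonneg (norm_nonneg _)).2 fun j => ?_)
  have h := norm_le_pi_norm (reindexV v) (slotEquiv k n j)
  simpa [reindexV] using h

/-- Reindexing is continuous. [folklore] -/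
theorem continuous_reindexV : Continuous (reindexV (k := k) (n := n)) :=
  continuous_pi fun _ => continuous_apply _

/-- Reindexing an update is updating the reindexed parameters. [folklore] -/
theorem reindexV_update (v : Fin (slotK k n + 1) → ℝ) (j : Fin (slotK k n + 1)) (x : ℝ) :
    reindexV (Function.update v j x) = Function.update (reindexV v) (slotEquiv k n j) x := by
  funext p
  simp only [reindexV]
  by_cases hp : p = slotEquiv k n j
  · rw [hp]; simp
  · rw [Function.update_of_ne hp, Function.update_of_ne (fun h => hp (by rw [← h]; simp))]
    rfl

omit [NeZero n] in
/-- `insertNth j x v' = update (insertNth j 0 v') j x`. [folklore] -/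
theorem insertNth_eq_update {m : ℕ} (j : Fin (m + 1)) (x : ℝ) (v' : Fin m → ℝ) :
    (j.insertNth x v' : Fin (m + 1) → ℝ) = Function.update (j.insertNth 0 v' : Fin (m + 1) → ℝ) j x := by
  funext l
  rcases Fin.eq_self_or_eq_succAbove j l with rfl | ⟨l', rfl⟩
  · simp
  · rw [Fin.insertNth_apply_succAbove, Function.update_of_ne (Fin.succAbove_ne j l'), Fin.insertNth_apply_succAbove]

omit [NeZero n] in
/-- `‖insertNth j 0 v'‖ = ‖v'‖`. [folklore] -/
theorem norm_insertNth_zero {m : ℕ} (j : Fin (m + 1)) (v' : Fin m → ℝ) :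
    ‖(j.insertNth (0 : ℝ) v' : Fin (m + 1) → ℝ)‖ = ‖v'‖ := by
  refine le_antisymm ((pi_norm_le_iff_of_nonneg (norm_nonneg _)).2 fun l => ?_)
    ((pi_norm_le_iff_of_nonneg (norm_nonneg _)).2 fun l' => ?_)
  · rcases Fin.eq_self_or_eq_succAbove j l with rfl | ⟨l', rfl⟩
    · simp
    · rw [Fin.insertNth_apply_succAbove]; exact norm_le_pi_norm v' l'
  · have h := norm_le_pi_norm (j.insertNth (0 : ℝ) v' : Fin (m + 1) → ℝ) (j.succAbove l')
    rwa [Fin.insertNth_apply_succAbove] at h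

omit [NeZero n] in
/-- Nonnegativity of `insertNth j 0 v'` for `v' ≥ 0`. [folklore] -/
theorem insertNth_zero_nonneg {m : ℕ} (j : Fin (m + 1)) {v' : Fin m → ℝ} (hv : ∀ l, 0 ≤ v' l)
    (l : Fin (m + 1)) : 0 ≤ (j.insertNth (0 : ℝ) v' : Fin (m + 1) → ℝ) l := by
  rcases Fin.eq_self_or_eq_succAbove j l with rfl | ⟨l', rfl⟩
  · simp
  · rw [Fin.insertNth_apply_succAbove]; exact hv l'

end Reindex

/-! ### The theorem -/

section Main

variable (𝔖 : SchwingerFamily (EuclideanSpace ℝ (Fin d))) (hE1 : 𝔖.IsEuclideanCovariant)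
  (hE2 : 𝔖.IsOSReflectionPositive) {k : ℕ} (φ : Fin (k + 2) → 𝓢(EuclideanSpace ℝ (Fin d), ℂ))
  (ξ : Fin (k + 1) → EuclideanSpace ℝ (Fin d)) (ê : Fin d → EuclideanSpace ℝ (Fin d)) {g r b : ℝ}
  (hφ : ∀ j, tsupport (φ j : EuclideanSpace ℝ (Fin d) → ℂ) ⊆ Metric.closedBall 0 r)
  (hê1 : ∀ μ, ‖ê μ‖ = 1) (hêê : ∀ μ ν, 0 ≤ ⟪ê μ, ê ν⟫) (hξ : ∀ μ i', g ≤ ⟪ê μ, ξ i'⟫)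
  (hg : 2 * r < g) (hr : 0 ≤ r) (hb : 0 < b)

/-- The directional skeleton Schwinger function in the reindexed parameters. [folklore] -/
def skelSVr (v : Fin (slotK k d + 1) → ℝ) : ℂ := skelSV 𝔖 φ ξ ê (reindexV v)

/-- The slot families in the reindexed parameters: slot `j ↔ (i, μ) = slotEquiv j`, other
parameters `v'` inserted with slot value `0`. [folklore] -/
def slotEr (j : Fin (slotK k d + 1)) (v' : Fin (slotK k d) → ℝ) (τ : ℂ) : ℂ :=
  slotExtV 𝔖 hE1 hE2 φ ξ ê (slotEquiv k d j).1 (slotEquiv k d j).2 hφ (hê1 _) (hêê _) (hξ _) hg hr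
    (reindexV (j.insertNth (0 : ℝ) v')) τ

include hE1 hE2 hφ hê1 hêê hξ hg hr hb

/-- **Joint real analyticity of the directional skeleton Schwinger function** (Osterwalder–Schrader
II, Thm. 4.1' for the profile-smeared Schwinger function, Method B): there is `F` holomorphic on
`{∑ⱼ |Im zⱼ| < π/2}` (`j ∈ Fin ((k+1)d)` the reindexed slots `(i, μ)`), bounded on closed
sub-tubes, with `F(x) = e^{-2b∑xⱼ²} 𝒮(eˣ)` at real points, where
`𝒮(u) = 𝔖_{k+2}(⊗ⱼ φⱼ(· - pⱼ(u)))`. [cite: OsterwalderSchraderCMP1975, Ch. V.1 Thm. 4.1', eqs. (5.7)–(5.8)] -/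
theorem exists_holomorphic_extension_skelSV :
    ∃ F : (Fin (slotK k d + 1) → ℂ) → ℂ,
      DifferentiableOn ℂ F {z : Fin (slotK k d + 1) → ℂ | ∑ j, |(z j).im| < Real.pi / 2} ∧
      (∀ c : ℝ, c < Real.pi / 2 → ∃ K : ℝ, ∀ z : Fin (slotK k d + 1) → ℂ,
        ∑ j, |(z j).im| ≤ c → ‖F z‖ ≤ K) ∧
      ∀ x : Fin (slotK k d + 1) → ℝ,
        F (fun j => (x j : ℂ)) = LogSlot.logDensity (skelSVr 𝔖 φ ξ ê) b x := by
  -- the bounds of `𝒮` and of the slot functions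
  obtain ⟨C₀, N₀, -, hS⟩ := exists_norm_skelSV_le 𝔖 φ ξ ê
  have hSb : ∀ v, ‖skelSVr 𝔖 φ ξ ê v‖ ≤ C₀ * (1 + ‖v‖) ^ N₀ := fun v => by
    have h := hS (reindexV v); rwa [norm_reindexV] at h
  have hSc : Continuous (skelSVr 𝔖 φ ξ ê) := (continuous_skelSV 𝔖 φ ξ ê).comp continuous_reindexV
  have hEc : ∀ j τ, Continuous fun v' => slotEr 𝔖 hE1 hE2 φ ξ ê hφ hê1 hêê hξ hg hr j v' τ := fun j τ =>
    (continuous_slotExtV_left 𝔖 hE1 hE2 φ ξ ê _ _ hφ (hê1 _) (hêê _) (hξ _) hg hr τ).comp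
      (continuous_reindexV.comp (Continuous.finInsertNth j continuous_const continuous_id))
  have hEd : ∀ j v', DifferentiableOn ℂ (slotEr 𝔖 hE1 hE2 φ ξ ê hφ hê1 hêê hξ hg hr j v') {τ : ℂ | 0 < τ.re} :=
    fun j v' => differentiableOn_slotExtV 𝔖 hE1 hE2 φ ξ ê _ _ hφ (hê1 _) (hêê _) (hξ _) hg hr _
  have hEb : ∀ j, ∃ (C : ℝ) (N : ℕ), 0 ≤ C ∧ ∀ (v' : Fin (slotK k d) → ℝ) (τ : ℂ), 0 ≤ τ.re →
      ‖slotEr 𝔖 hE1 hE2 φ ξ ê hφ hê1 hêê hξ hg hr j v' τ‖ ≤ C * (1 + ‖v'‖) ^ N := by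
    intro j
    obtain ⟨C, N, hC, h⟩ := exists_norm_slotExtV_le 𝔖 hE1 hE2 φ ξ ê (slotEquiv k d j).1 (slotEquiv k d j).2
      hφ (hê1 _) (hêê _) (hξ _) hg hr
    refine ⟨C, N, hC, fun v' τ hτ => (h _ τ hτ).trans (le_of_eq ?_)⟩
    rw [norm_reindexV, norm_insertNth_zero]
  have hES : ∀ j (v' : Fin (slotK k d) → ℝ), (∀ l, 0 ≤ v' l) → ∀ x : ℝ, 0 ≤ x →
      slotEr 𝔖 hE1 hE2 φ ξ ê hφ hê1 hêê hξ hg hr j v' x = skelSVr 𝔖 φ ξ ê (j.insertNth x v') := by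
    intro j v' hv x hx
    have hu : ∀ p, 0 ≤ reindexV (j.insertNth (0 : ℝ) v') p := fun p => insertNth_zero_nonneg j hv _
    rw [slotEr, slotExtV_ofReal 𝔖 hE1 hE2 φ ξ ê _ _ hφ (hê1 _) (hêê _) (hξ _) hg hr hu hx, skelSVr,
      insertNth_eq_update j x v', reindexV_update]
  exact LogSlot.exists_holomorphic_extension_logDensity (skelSVr 𝔖 φ ξ ê)
    (slotEr 𝔖 hE1 hE2 φ ξ ê hφ hê1 hêê hξ hg hr) hb hSc hSb hEc hEd hEb hES

/-- **Osterwalder–Schrader's (5.8) for the directional skeleton Schwinger function**: there is a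
function `S̃` holomorphic on the sector tube `{w | ∑ⱼ |arg wⱼ| < π/2}` (so `Re wⱼ > 0`) with
`S̃(u) = 𝒮(u)` for all `u ∈ (0,∞)^{(k+1)d}` — "a function `S_k(ζ + u e)` analytic in
`{w | ∑ |arg w_i^μ| < π/2}` whose restriction to real arguments" is the (profile-smeared)
Schwinger function (OS II p. 292). [cite: OsterwalderSchraderCMP1975, Ch. V.1 eq. (5.8)] -/
theorem exists_holomorphic_sector_extension_skelSV :
    ∃ St : (Fin (slotK k d + 1) → ℂ) → ℂ,
      DifferentiableOn ℂ St {w : Fin (slotK k d + 1) → ℂ | (∀ j, 0 < (w j).re) ∧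
        ∑ j, |Complex.arg (w j)| < Real.pi / 2} ∧
      ∀ u : Fin (slotK k d + 1) → ℝ, (∀ j, 0 < u j) → St (fun j => (u j : ℂ)) = skelSVr 𝔖 φ ξ ê u := by
  obtain ⟨F, hF, -, hFx⟩ := exists_holomorphic_extension_skelSV 𝔖 hE1 hE2 φ ξ ê hφ hê1 hêê hξ hg hr hb
  set U : Set (Fin (slotK k d + 1) → ℂ) :=
    {w | (∀ j, 0 < (w j).re) ∧ ∑ j, |Complex.arg (w j)| < Real.pi / 2} with hU
  set L : (Fin (slotK k d + 1) → ℂ) → (Fin (slotK k d + 1) → ℂ) := fun w j => Complex.log (w j) with hL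
  refine ⟨fun w => Complex.exp ((2 * b : ℂ) * ∑ j, (Complex.log (w j)) ^ 2) * F (L w), ?_, fun u hu => ?_⟩
  · -- holomorphy: `log` is holomorphic on `Re > 0`, and `L` maps the sector tube into the `ℓ¹` tube
    have hlogj : ∀ j, DifferentiableOn ℂ (fun w : Fin (slotK k d + 1) → ℂ => Complex.log (w j)) U :=
      fun j w hw => ((differentiableAt_apply (𝕜 := ℂ) j w).clog (Or.inl (hw.1 j))).differentiableWithinAt
    have hLd : DifferentiableOn ℂ L U := differentiableOn_pi.2 fun j => hlogj j
    have hmaps : MapsTo L U {z : Fin (slotK k d + 1) → ℂ | ∑ j, |(z j).im| < Real.pi / 2} := by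
      intro w hw
      simp only [hL, mem_setOf_eq, Complex.log_im]
      exact hw.2
    refine DifferentiableOn.mul ?_ (hF.comp hLd hmaps)
    exact ((differentiableOn_const _).mul (DifferentiableOn.fun_sum fun j _ => (hlogj j).pow 2)).cexp
  · -- real points: `log u` is real, `F(log u) = e^{-2b∑log²u} 𝒮(e^{log u}) = e^{-2b∑log²u} 𝒮(u)`
    have hLu : L (fun j => (u j : ℂ)) = fun j => ((Real.log (u j) : ℝ) : ℂ) := by
      funext j; simp only [hL]; rw [Complex.ofReal_log (hu j).le]
    simp only
    rw [hLu, hFx, LogSlot.logDensity]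
    have hexp : expPi (fun j => Real.log (u j)) = u := funext fun j => Real.exp_log (hu j)
    rw [hexp, ← mul_assoc, ← Complex.exp_add]
    have h0 : (2 * b : ℂ) * ∑ j, Complex.log (u j : ℂ) ^ 2 + -(2 * b : ℂ) * ∑ j, ((Real.log (u j) : ℝ) : ℂ) ^ 2 = 0 := by
      have : ∀ j, Complex.log (u j : ℂ) = ((Real.log (u j) : ℝ) : ℂ) := fun j => (Complex.ofReal_log (hu j).le).symm
      simp_rw [this]; ring
    rw [h0, Complex.exp_zero, one_mul]

end Main

end Literature.MathematicalPhysics.QuantumFieldTheory
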